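import Summits.SmoothPoincare4.SmoothPoincare4.Theorems.CylinderEntropySliceIsolationCertDataA1
import Summits.SmoothPoincare4.SmoothPoincare4.Theorems.CylinderEntropySliceIsolationCertDataA2
import Summits.SmoothPoincare4.SmoothPoincare4.Theorems.CylinderEntropySliceIsolationCertDataA3
import HarnessLib

/-!
# Stub `stub_certMidA`: the mid-scale kernel certificates on the decade `1 / 100 ≤ T ≤ 1 / 10`

Line `conformal-kernel-domination` of the crux `Summit.SmoothPoincare4.SmoothPoincare4.Theses.CylinderEntropy.SliceIsolation`
(crux item stmt-SmoothPoincare4-7632).  The registered stub `stub_certMidA` — for every normalised scale `T` of the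
decade finitely many on-axis zonal atoms plus an area atom, of total mass `≤ 147/100`, dominating the pulled-back
Euclidean kernel for all `u ∈ ℝ`, `s ∈ [-1, 1]` — assembled from the data helpers
`helper_certDataA1`, `helper_certDataA2`, `helper_certDataA3` (certificate cells accepted by the kernel-sound computable checker
`Cert.checkCover`, evaluated by `native_decide`; this file is therefore COMPUTATIONAL as well).  Pure case split on `T`.
-/

-- the registered namespace `Summit.SmoothPoincare4.SmoothPoincare4.Theorems…` repeats a component
set_option linter.dupNamespace false

namespace Summit.SmoothPoincare4.SmoothPoincare4.Theorems.CylinderEntropySliceIsolation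

open Literature.Geometry.Riemannian.SphericalCylinderEntropy

/-- **Registered stub `stub_certMidA`** of crux stmt-SmoothPoincare4-7632 (line `conformal-kernel-domination`, chain β):
the mid-scale kernel certificates for `1 / 100 ≤ T ≤ 1 / 10`. [folklore] -/
theorem stub_certMidA :
    ∀ T : ℝ, 1 / 100 ≤ T → T ≤ 1 / 10 →
      ∃ (n : ℕ) (σ τ w : Fin n → ℝ) (c : ℝ), (∀ j, 0 < τ j) ∧ (∀ j, 0 ≤ w j) ∧ 0 ≤ c ∧ (∑ j, w j) + c ≤ 147 / 100 ∧
        ∀ u s : ℝ, -1 ≤ s → s ≤ 1 →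
          (8 * Real.pi ^ 2 / 3) * ((4 * Real.pi * T) ^ 2)⁻¹ * Real.exp (4 * u) *
              Real.exp (-(Real.exp (2 * u) - 2 * Real.exp u * s + 1) / (4 * T)) ≤
            (∑ j, w j * (zonal (τ j) s * Real.exp (-(u - σ j) ^ 2 / (4 * τ j)))) + c := by
  intro T h1 h2
  have hlo : ((1 / 100 : ℚ) : ℝ) ≤ T := le_trans (by norm_num) h1
  by_cases hc0 : T ≤ ((22037 / 953929 : ℚ) : ℝ)
  · exact helper_certDataA1 T hlo hc0
  replace hlo : ((22037 / 953929 : ℚ) : ℝ) ≤ T :=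
    le_trans (by norm_num : ((22037 / 953929 : ℚ) : ℝ) ≤ ((22037 / 953929 : ℚ) : ℝ)) (not_le.1 hc0).le
  by_cases hc1 : T ≤ ((53108 / 995147 : ℚ) : ℝ)
  · exact helper_certDataA2 T hlo hc1
  replace hlo : ((53108 / 995147 : ℚ) : ℝ) ≤ T :=
    le_trans (by norm_num : ((53108 / 995147 : ℚ) : ℝ) ≤ ((53108 / 995147 : ℚ) : ℝ)) (not_le.1 hc1).le
  exact helper_certDataA3 T hlo (h2.trans (by norm_num))

end Summit.SmoothPoincare4.SmoothPoincare4.Theorems.CylinderEntropySliceIsolation
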